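import Literature.NumberTheory.GaloisRepresentations.LubinTateUnramifiedTrace
import HarnessLib

/-!
# The trace down the base `E₂ → E₁` on integers: `Tr_{E₂/E₁} : 𝒪_{E₂} → 𝒪_{E₁}`, as a sum over `Gal(E₂/E₁)`, transitive, Galois-equivariant,
# continuous — the transition maps of `lim←_{k′} 𝒪_{k′}` (de Shalit I §3.8 (16), III §1.3)

De Shalit, *Iwasawa theory of elliptic curves with complex multiplication* (1987), Ch. I §3.8: the structure theorem I.3.7 over an
unramified base `k′` is assembled over the tower `k′ ⊂ k″ ⊂ ⋯ ⊂ k^{ur}` along the vertical arrows of diagram (16) — on units the norms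
`N_{k″/k′}`, on the coordinates `𝒪_{k″}⟦Y⟧ → 𝒪_{k′}⟦Y⟧` the TRACES (`relUnitCoordTwo_baseNorm`: `ι r_{Nβ} = Σ_{σ ∈ Gal(k″/k′)} r_β^σ`).
This file supplies the trace `Tr_{E₂/E₁}` on the valuation rings as an honest `𝒪_F`-linear map (so far the tree only had the formula
`ι(·) = Σ_σ σ(·)` inside `𝒪_{E₂}`), for finite subextensions `E₁ ≤ E₂` of `F̄` with `E₂/F` Galois:

* `towerRestrict h : Aut_F(E₂) →* Aut_F(E₁)` (`E₁` normal; Mathlib `restrictNormalHom` along the tower algebra), `inclusion_towerRestrict_apply`,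
  `towerRestrict_surjective`, ★ `towerRestrict_eq_one_iff` (kernel = the automorphisms fixing `E₁` pointwise), `towerRestrict_eq_iff`;
* `algebraMap_towerTrace_eq_sum` — `ι(Tr_{E₂/E₁} x) = Σ_{σ ∈ Aut_F(E₂), σ|_{E₁} = id} σ x`; `norm_towerTrace_le` — `‖Tr x‖ ≤ ‖x‖`;
* `unitBallTrace h : 𝒪_{E₂} →ₗ[𝒪_F] 𝒪_{E₁}` with `coe_unitBallTrace`, ★ `inclUnitBall_unitBallTrace` (`ι ∘ Tr = Σ_σ σ`), `unitBallTrace_refl`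
  (`Tr_{E/E} = id`), ★ `unitBallTrace_unitBallTrace` (transitivity along `E₁ ≤ E₂ ≤ E₃`), ★ `unitBallTrace_unitBallEquiv`
  (`Tr(σ x) = σ|_{E₁}(Tr x)`), ★ `inclUnitBall_unitBallEquiv_unitBallTrace` (`ι(σ̄ (Tr x)) = Σ_{σ|_{E₁} = σ̄} σ x` — the fibre formula),
  `continuous_unitBallTrace`.

Everything PROVED (0 sorry, no named facts).  Sequel: `LubinTateUnramifiedTraceCoherentNormalBasis` (trace-coherent integral normal bases
along an unramified tower, the series-currency description of `lim←_{k′} 𝒪_{k′}⟦Y⟧`).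

## References

* E. de Shalit, *Iwasawa theory of elliptic curves with complex multiplication* (1987), Ch. I §3.8 (16)–(17); Ch. III §1.3. [deShalit1987]
* J.-P. Serre, *Local Fields* (1979), Ch. I §7 Prop. 21, Ch. II §2, Ch. V §2. [SerreLocalFields1979]
-/

noncomputable section

namespace Literature.NumberTheory.GaloisRepresentations

section TowerTrace

open GaloisRepresentations.IsNonarchimedeanLocalField LubinTate ValuativeRel Field

variable {F : Type} [Field F] [ValuativeRel F] [TopologicalSpace F] [IsNonarchimedeanLocalField F]

attribute [local instance] ltNormUniformSpace ltNormIsUniformAddGroup rk1 nF nE fintypeResidueField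

variable {E₁ E₂ E₃ : IntermediateField F (AlgebraicClosure F)}

/-! ### Restriction `Aut_F(E₂) → Aut_F(E₁)` along `E₁ ≤ E₂` -/

omit [ValuativeRel F] [TopologicalSpace F] [IsNonarchimedeanLocalField F] in
/-- **`σ ↦ σ|_{E₁}`: restriction of `F`-automorphisms of `E₂` to a normal `E₁ ≤ E₂`** (Mathlib `restrictNormalHom` for the tower algebra).
[cite: SerreLocalFields1979, Ch. I §7 Prop. 21] -/
def towerRestrict [Normal F E₁] (h : E₁ ≤ E₂) : (E₂ ≃ₐ[F] E₂) →* (E₁ ≃ₐ[F] E₁) :=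
  letI : Algebra E₁ E₂ := towerAlgebra h
  haveI : IsScalarTower F E₁ E₂ := towerAlgebra_isScalarTower h
  AlgEquiv.restrictNormalHom E₁

omit [ValuativeRel F] [TopologicalSpace F] [IsNonarchimedeanLocalField F] in
/-- `ι(σ|_{E₁} x) = σ(ι x)`. [cite: SerreLocalFields1979, Ch. I §7 Prop. 21] -/
theorem inclusion_towerRestrict_apply [Normal F E₁] (h : E₁ ≤ E₂) (σ : E₂ ≃ₐ[F] E₂) (x : E₁) :
    IntermediateField.inclusion h (towerRestrict h σ x) = σ (IntermediateField.inclusion h x) := by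
  letI : Algebra E₁ E₂ := towerAlgebra h
  haveI : IsScalarTower F E₁ E₂ := towerAlgebra_isScalarTower h
  exact AlgEquiv.restrictNormal_commutes σ E₁ x

omit [ValuativeRel F] [TopologicalSpace F] [IsNonarchimedeanLocalField F] in
/-- **`σ ↦ σ|_{E₁}` is onto** when `E₂` is normal as well (automorphisms extend). [cite: SerreLocalFields1979, Ch. I §7 Prop. 21] -/
theorem towerRestrict_surjective [Normal F E₁] [Normal F E₂] (h : E₁ ≤ E₂) : Function.Surjective (towerRestrict h) := by
  letI : Algebra E₁ E₂ := towerAlgebra h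
  haveI : IsScalarTower F E₁ E₂ := towerAlgebra_isScalarTower h
  exact AlgEquiv.restrictNormalHom_surjective (F := F) (K₁ := E₁) (E := E₂)

omit [ValuativeRel F] [TopologicalSpace F] [IsNonarchimedeanLocalField F] in
/-- ★ **Kernel of the restriction**: `σ|_{E₁} = 1 ↔ σ` fixes `E₁` pointwise. [cite: SerreLocalFields1979, Ch. I §7 Prop. 21] -/
theorem towerRestrict_eq_one_iff [Normal F E₁] (h : E₁ ≤ E₂) (σ : E₂ ≃ₐ[F] E₂) :
    towerRestrict h σ = 1 ↔ ∀ y : E₁, σ (IntermediateField.inclusion h y) = IntermediateField.inclusion h y := by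
  constructor
  · intro hσ y
    rw [← inclusion_towerRestrict_apply h σ y, hσ, AlgEquiv.one_apply]
  · intro hσ
    refine AlgEquiv.ext fun y => IntermediateField.inclusion_injective h ?_
    rw [inclusion_towerRestrict_apply, hσ, AlgEquiv.one_apply]

omit [ValuativeRel F] [TopologicalSpace F] [IsNonarchimedeanLocalField F] in
/-- Two automorphisms have the same restriction iff they differ by one fixing `E₁`: `σ|_{E₁} = τ|_{E₁} ↔ (τ⁻¹σ)|_{E₁} = 1`.
[cite: SerreLocalFields1979, Ch. I §7 Prop. 21] -/
theorem towerRestrict_eq_iff [Normal F E₁] (h : E₁ ≤ E₂) (σ τ : E₂ ≃ₐ[F] E₂) :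
    towerRestrict h σ = towerRestrict h τ ↔ towerRestrict h (τ⁻¹ * σ) = 1 := by
  rw [map_mul, map_inv, inv_mul_eq_one, eq_comm]

/-! ### The trace as a sum over the automorphisms fixing `E₁` -/

omit [ValuativeRel F] [TopologicalSpace F] [IsNonarchimedeanLocalField F] in
/-- **The relative trace as a sum over the automorphisms fixing `E₁`**: for `E₂/F` finite Galois and `E₁ ≤ E₂`,
`ι(Tr_{E₂/E₁} x) = Σ_{σ ∈ Aut_F(E₂), σ|_{E₁} = id} σ x`. [cite: SerreLocalFields1979, Ch. V §2] -/
theorem algebraMap_towerTrace_eq_sum [FiniteDimensional F E₂] [IsGalois F E₂] (h : E₁ ≤ E₂) (x : E₂) :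
    open scoped Classical in
    IntermediateField.inclusion h (@Algebra.trace E₁ E₂ _ _ (towerAlgebra h) x) =
      ∑ σ ∈ Finset.univ.filter (fun σ : E₂ ≃ₐ[F] E₂ =>
        ∀ y : E₁, σ (IntermediateField.inclusion h y) = IntermediateField.inclusion h y), σ x := by
  classical
  letI := towerAlgebra h
  haveI := towerAlgebra_isScalarTower h
  haveI : FiniteDimensional E₁ E₂ := FiniteDimensional.right F E₁ E₂
  haveI : IsGalois E₁ E₂ := IsGalois.tower_top_of_isGalois F E₁ E₂
  have h1 : IntermediateField.inclusion h (Algebra.trace E₁ E₂ x) = algebraMap E₁ E₂ (Algebra.trace E₁ E₂ x) := rfl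
  rw [h1, trace_eq_sum_automorphisms]
  refine Finset.sum_bij (fun τ _ => AlgEquiv.restrictScalars F τ) (fun τ _ => ?_)
    (fun τ₁ _ τ₂ _ h12 => AlgEquiv.restrictScalars_injective F h12) (fun σ hσ => ?_) (fun τ _ => rfl)
  · rw [Finset.mem_filter]
    exact ⟨Finset.mem_univ _, fun y => τ.commutes y⟩
  · rw [Finset.mem_filter] at hσ
    refine ⟨{ σ with commutes' := fun y => hσ.2 y }, Finset.mem_univ _, ?_⟩
    ext z
    rfl

/-- **`‖Tr_{E₂/E₁} x‖ ≤ ‖x‖`** (a sum of conjugates, all of the same absolute value; the norm is non-archimedean).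
[cite: SerreLocalFields1979, Ch. II §2 Cor. 3] -/
theorem norm_towerTrace_le [FiniteDimensional F E₁] [FiniteDimensional F E₂] [IsGalois F E₂] (h : E₁ ≤ E₂) (x : E₂) :
    ‖@Algebra.trace E₁ E₂ _ _ (towerAlgebra h) x‖ ≤ ‖x‖ := by
  classical
  rw [← norm_inclusion h, algebraMap_towerTrace_eq_sum h]
  refine IsUltrametricDist.norm_sum_le_of_forall_le_of_nonneg (norm_nonneg x) fun σ _ => ?_
  rw [norm_algEquiv]

/-! ### The trace on the valuation rings -/

variable [FiniteDimensional F E₁] [FiniteDimensional F E₂] [FiniteDimensional F E₃]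

/-- **`Tr_{E₂/E₁} : 𝒪_{E₂} → 𝒪_{E₁}`**, the relative trace on integers (`‖Tr x‖ ≤ ‖x‖ ≤ 1`), as an `𝒪_F`-linear map — the transition
map `𝒪_{k″} → 𝒪_{k′}` of de Shalit's inverse system over the unramified layers. [cite: deShalit1987, Ch. I §3.8 (16)] -/
def unitBallTrace [IsGalois F E₂] (h : E₁ ≤ E₂) : unitBall E₂ →ₗ[𝒪[F]] unitBall E₁ where
  toFun x := ⟨@Algebra.trace E₁ E₂ _ _ (towerAlgebra h) (x : E₂),
    (mem_unitBall_iff E₁).mpr ((norm_towerTrace_le h (x : E₂)).trans ((mem_unitBall_iff E₂).mp x.2))⟩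
  map_add' x y := Subtype.ext (by
    change @Algebra.trace E₁ E₂ _ _ (towerAlgebra h) ((x : E₂) + (y : E₂)) =
      @Algebra.trace E₁ E₂ _ _ (towerAlgebra h) (x : E₂) + @Algebra.trace E₁ E₂ _ _ (towerAlgebra h) (y : E₂)
    exact map_add _ _ _)
  map_smul' a x := Subtype.ext (by
    letI := towerAlgebra h
    haveI := towerAlgebra_isScalarTower h
    change Algebra.trace E₁ E₂ (((a • x : unitBall E₂) : E₂)) = (((a • (⟨Algebra.trace E₁ E₂ (x : E₂), _⟩ : unitBall E₁)) : unitBall E₁) : E₁)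
    have e2 : ((a • x : unitBall E₂) : E₂) = algebraMap E₁ E₂ (algebraMap F E₁ (a : F)) * (x : E₂) := by
      rw [Algebra.smul_def, Subring.coe_mul, algebraMap_integer_apply, ← IsScalarTower.algebraMap_apply F E₁ E₂]
    have e1 : ∀ z : unitBall E₁, (((a • z : unitBall E₁)) : E₁) = algebraMap F E₁ (a : F) * (z : E₁) := fun z => by
      rw [Algebra.smul_def, Subring.coe_mul, algebraMap_integer_apply]
    rw [e1, e2, ← Algebra.smul_def, map_smul, smul_eq_mul])

/-- `unitBallTrace h x` is the trace (unfolding). [cite: deShalit1987, Ch. I §3.8 (16)] -/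
theorem coe_unitBallTrace [IsGalois F E₂] (h : E₁ ≤ E₂) (x : unitBall E₂) :
    ((unitBallTrace h x : unitBall E₁) : E₁) = @Algebra.trace E₁ E₂ _ _ (towerAlgebra h) (x : E₂) := rfl

/-- ★ **`ι(Tr x) = Σ_{σ|_{E₁} = id} σ x` in `𝒪_{E₂}`.** [cite: deShalit1987, Ch. I §3.8 (16)] -/
theorem inclUnitBall_unitBallTrace [IsGalois F E₂] (h : E₁ ≤ E₂) (x : unitBall E₂) :
    open scoped Classical in
    inclUnitBall (F := F) h (unitBallTrace h x) =
      ∑ σ ∈ Finset.univ.filter (fun σ : E₂ ≃ₐ[F] E₂ =>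
        ∀ y : E₁, σ (IntermediateField.inclusion h y) = IntermediateField.inclusion h y), unitBallEquiv E₂ σ x := by
  classical
  apply Subtype.ext
  rw [coe_inclUnitBall, coe_unitBallTrace, algebraMap_towerTrace_eq_sum h, AddSubmonoidClass.coe_finsetSum]
  rfl

/-- With the restriction map: `ι(Tr x) = Σ_{towerRestrict σ = 1} σ x`. [cite: deShalit1987, Ch. I §3.8 (16)] -/
theorem inclUnitBall_unitBallTrace_eq_sum_towerRestrict [Normal F E₁] [IsGalois F E₂] (h : E₁ ≤ E₂) (x : unitBall E₂) :
    open scoped Classical in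
    inclUnitBall (F := F) h (unitBallTrace h x) =
      ∑ σ ∈ Finset.univ.filter (fun σ : E₂ ≃ₐ[F] E₂ => towerRestrict h σ = 1), unitBallEquiv E₂ σ x := by
  classical
  rw [inclUnitBall_unitBallTrace]
  exact Finset.sum_congr (Finset.filter_congr fun σ _ => (towerRestrict_eq_one_iff h σ).symm) fun _ _ => rfl

/-- **`Tr_{E/E} = id`** on `𝒪_E`. [cite: SerreLocalFields1979, Ch. V §2] -/
theorem unitBallTrace_refl [IsGalois F E₂] (x : unitBall E₂) : unitBallTrace (le_refl E₂) x = x := by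
  classical
  apply inclUnitBall_injective (le_refl E₂)
  rw [inclUnitBall_unitBallTrace]
  have hfilter : Finset.univ.filter (fun σ : E₂ ≃ₐ[F] E₂ =>
      ∀ y : E₂, σ (IntermediateField.inclusion (le_refl E₂) y) = IntermediateField.inclusion (le_refl E₂) y) = {1} := by
    ext σ
    simp only [Finset.mem_filter, Finset.mem_univ, true_and, Finset.mem_singleton]
    constructor
    · intro hσ
      refine AlgEquiv.ext fun y => ?_
      have hy := hσ y
      have e : IntermediateField.inclusion (le_refl E₂) y = y := Subtype.ext rfl
      rw [e] at hy
      rw [hy, AlgEquiv.one_apply]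
    · rintro rfl y
      rfl
  rw [hfilter, Finset.sum_singleton]
  apply Subtype.ext
  rw [coe_inclUnitBall, coe_unitBallEquiv, AlgEquiv.one_apply]
  exact Subtype.ext rfl

/-- ★ **Transitivity `Tr_{E₂/E₁} ∘ Tr_{E₃/E₂} = Tr_{E₃/E₁}`** on integers along `E₁ ≤ E₂ ≤ E₃` (Mathlib `Algebra.trace_trace`).
[cite: SerreLocalFields1979, Ch. II §2] -/
theorem unitBallTrace_unitBallTrace [IsGalois F E₂] [IsGalois F E₃] (h₁₂ : E₁ ≤ E₂) (h₂₃ : E₂ ≤ E₃) (x : unitBall E₃) :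
    unitBallTrace h₁₂ (unitBallTrace h₂₃ x) = unitBallTrace (h₁₂.trans h₂₃) x := by
  apply Subtype.ext
  rw [coe_unitBallTrace, coe_unitBallTrace, coe_unitBallTrace]
  letI : Algebra E₁ E₂ := towerAlgebra h₁₂
  letI : Algebra E₂ E₃ := towerAlgebra h₂₃
  letI : Algebra E₁ E₃ := towerAlgebra (h₁₂.trans h₂₃)
  haveI : IsScalarTower E₁ E₂ E₃ := IsScalarTower.of_algebraMap_eq fun _ => rfl
  haveI := towerAlgebra_isScalarTower h₁₂
  haveI := towerAlgebra_isScalarTower h₂₃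
  haveI : FiniteDimensional E₁ E₂ := FiniteDimensional.right F E₁ E₂
  haveI : FiniteDimensional E₂ E₃ := FiniteDimensional.right F E₂ E₃
  haveI : Module.Free E₁ E₂ := Module.Free.of_divisionRing E₁ E₂
  haveI : Module.Free E₂ E₃ := Module.Free.of_divisionRing E₂ E₃
  exact Algebra.trace_trace (x : E₃)

/-- ★ **Galois-equivariance of the trace**: `Tr_{E₂/E₁}(σ x) = σ|_{E₁}(Tr_{E₂/E₁} x)` for `σ ∈ Aut_F(E₂)` (`E₁` normal: conjugation by `σ`
permutes the automorphisms fixing `E₁`). [cite: SerreLocalFields1979, Ch. V §2] -/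
theorem unitBallTrace_unitBallEquiv [Normal F E₁] [IsGalois F E₂] (h : E₁ ≤ E₂) (σ : E₂ ≃ₐ[F] E₂) (x : unitBall E₂) :
    unitBallTrace h (unitBallEquiv E₂ σ x) = unitBallEquiv E₁ (towerRestrict h σ) (unitBallTrace h x) := by
  classical
  apply inclUnitBall_injective h
  rw [inclUnitBall_unitBallTrace_eq_sum_towerRestrict]
  have e : inclUnitBall (F := F) h (unitBallEquiv E₁ (towerRestrict h σ) (unitBallTrace h x)) =
      unitBallEquiv E₂ σ (inclUnitBall (F := F) h (unitBallTrace h x)) := by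
    apply Subtype.ext
    rw [coe_inclUnitBall, coe_unitBallEquiv, coe_unitBallEquiv, coe_inclUnitBall, inclusion_towerRestrict_apply]
  rw [e, inclUnitBall_unitBallTrace_eq_sum_towerRestrict, map_sum]
  -- reindex `τ ↦ σ τ σ⁻¹`
  symm
  refine Finset.sum_bij (fun τ _ => σ * τ * σ⁻¹) (fun τ hτ => ?_) (fun τ₁ _ τ₂ _ h12 => ?_) (fun τ hτ => ?_) (fun τ _ => ?_)
  · rw [Finset.mem_filter] at hτ ⊢
    refine ⟨Finset.mem_univ _, ?_⟩
    rw [map_mul, map_mul, hτ.2, mul_one, map_inv, mul_inv_cancel]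
  · simpa using h12
  · rw [Finset.mem_filter] at hτ
    refine ⟨σ⁻¹ * τ * σ, ?_, by group⟩
    rw [Finset.mem_filter]
    refine ⟨Finset.mem_univ _, ?_⟩
    rw [map_mul, map_mul, hτ.2, mul_one, map_inv, inv_mul_cancel]
  · apply Subtype.ext
    simp only [coe_unitBallEquiv, AlgEquiv.mul_apply, AlgEquiv.aut_inv, AlgEquiv.symm_apply_apply]

/-- ★ **The fibre formula**: `ι(σ̄ (Tr_{E₂/E₁} x)) = Σ_{σ ∈ Aut_F(E₂), σ|_{E₁} = σ̄} σ x` for `σ̄ ∈ Aut_F(E₁)` (`E₂` normal, so that `σ̄` lifts).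
[cite: SerreLocalFields1979, Ch. V §2] -/
theorem inclUnitBall_unitBallEquiv_unitBallTrace [Normal F E₁] [IsGalois F E₂] (h : E₁ ≤ E₂) (σbar : E₁ ≃ₐ[F] E₁) (x : unitBall E₂) :
    open scoped Classical in
    inclUnitBall (F := F) h (unitBallEquiv E₁ σbar (unitBallTrace h x)) =
      ∑ σ ∈ Finset.univ.filter (fun σ : E₂ ≃ₐ[F] E₂ => towerRestrict h σ = σbar), unitBallEquiv E₂ σ x := by
  classical
  obtain ⟨σl, hσl⟩ := towerRestrict_surjective h σbar
  have e : inclUnitBall (F := F) h (unitBallEquiv E₁ σbar (unitBallTrace h x)) =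
      unitBallEquiv E₂ σl (inclUnitBall (F := F) h (unitBallTrace h x)) := by
    apply Subtype.ext
    rw [coe_inclUnitBall, coe_unitBallEquiv, coe_unitBallEquiv, coe_inclUnitBall, ← hσl, inclusion_towerRestrict_apply]
  rw [e, inclUnitBall_unitBallTrace_eq_sum_towerRestrict, map_sum]
  refine Finset.sum_bij (fun τ _ => σl * τ) (fun τ hτ => ?_) (fun τ₁ _ τ₂ _ h12 => mul_left_cancel h12) (fun τ hτ => ?_)
    (fun τ _ => ?_)
  · rw [Finset.mem_filter] at hτ ⊢
    exact ⟨Finset.mem_univ _, by rw [map_mul, hτ.2, mul_one, hσl]⟩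
  · rw [Finset.mem_filter] at hτ
    refine ⟨σl⁻¹ * τ, ?_, by group⟩
    rw [Finset.mem_filter]
    exact ⟨Finset.mem_univ _, by rw [map_mul, map_inv, hτ.2, ← hσl, inv_mul_cancel]⟩
  · apply Subtype.ext
    rw [coe_unitBallEquiv, coe_unitBallEquiv, coe_unitBallEquiv, AlgEquiv.mul_apply]

/-- **`Tr_{E₂/E₁}` is continuous on `𝒪_{E₂}`** (`1`-Lipschitz: `‖Tr x − Tr y‖ = ‖Tr(x − y)‖ ≤ ‖x − y‖`). [cite: SerreLocalFields1979, Ch. II §2] -/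
theorem continuous_unitBallTrace [IsGalois F E₂] (h : E₁ ≤ E₂) : Continuous (unitBallTrace h) := by
  refine (LipschitzWith.of_dist_le_mul (K := 1) fun x y => ?_).continuous
  rw [NNReal.coe_one, one_mul, Subtype.dist_eq, Subtype.dist_eq, dist_eq_norm, dist_eq_norm, coe_unitBallTrace, coe_unitBallTrace,
    ← map_sub]
  have e : (x : E₂) - (y : E₂) = (((x - y : unitBall E₂)) : E₂) := by rw [AddSubgroupClass.coe_sub]
  rw [e]
  exact norm_towerTrace_le h _

end TowerTrace

end Literature.NumberTheory.GaloisRepresentations
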